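import Literature.NumberTheory.LFunctions.LandauGonekFormula
import Literature.NumberTheory.LFunctions.ZetaArgVariation
import Literature.NumberTheory.LFunctions.WeilZeroSum
import Summits.RiemannHypothesis.RiemannHypothesis.Theorems.HandoffLatticeTailRigidity

/-!
# Splittings — SCREW NULL COMBINATIONS V: a real Dirichlet-type polynomial vanishing at the on-line zeros is zero (Landau–Gonek)

Cell rh-split (brief sha16 f79c5f09d8bcb036), seat rh-split-typer-2 g3 (prover; own initiative on the cross/screw column,
announced HOME/STATUS.md 01:50Z): residual **R2** of target T2 (`ETAIL ⟺ FOZ`) of `cards/SPLIT-screw-bridge.md` §8/§9.  The seat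
rh-split-screw-bridge g4 re-expressed R2 («FOZ ⟹ the screw Gram matrices are eventually nonsingular») as «FOZ ⟹ NNC»,
NNC = «no non-zero finite real combination `t ↦ Σ_{j<n} z_j G_g(t, log(j+2))` of kernel sections vanishes at every node
`log(i+2)`» (`Splittings/ScrewBridgeRigidity.lean`, `inertiaOfFoz_iff_foz_imp_nnc`).  This file is part V of VI, step (iv):
`eq_zero_of_R_vanish_online` — if `R_z(ρ−½) = Σ_j z_j (1 − (j+2)^{−(ρ−½)}) = 0` for every ON-LINE non-trivial zero and only
finitely many zeros are off the line, then `z = 0`.  Mechanism: for each `k` sum `m(ρ)(k+2)^{ρ−½}R_z(ρ−½)` over `|Im ρ| ≤ T`;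
the tree's unconditional Landau–Gonek formula (`LandauGonek.landau_gonek_formula`, wrapped as `exists_landau_bound*`, with the
reflection `ρ ↦ 1 − ρ` for ratios `< 1`) makes every cross term `O(T)` while the diagonal is `z_k Σ_{|Im ρ|≤T} m(ρ) ≥ z_k N(T)`,
and `N(T)/T → ∞` by the tree's Riemann–von Mangoldt formula (`riemann_von_mangoldt_holds`, via the landed
`LatticeUncertainty.eventually_mul_le_zetaZeroCount`).  [folklore] plumbing around cited tree inputs.

HONEST LABEL: an RH-free theorem about Suzuki's screw kernel GIVEN finitely many off-line zeros; it discharges the residual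
R2 of a CONDITIONAL bridge (cell rh-split: «SPLITTING SEARCH over kernel-typed RH-EQUIVALENCES; a splitting A ∧ B ⟹ RH is
CONDITIONAL bookkeeping unless A and B are both proved») and nothing here bears on the truth of RH.
-/

set_option linter.dupNamespace false

noncomputable section

namespace Summit.RiemannHypothesis.RiemannHypothesis.Theorems.Splittings.ScrewNullComb


open Filter Topology Complex Finset
open scoped Real
open Literature.NumberTheory.LFunctions

/-! ## Landau–Gonek bounds `Σ_{|γ| ≤ T} m(ρ) x^{ρ−½} = O_x(T)` -/

/-- `(log T)² ≤ 4T` for `T ≥ 1`. [folklore] -/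
theorem log_sq_le (T : ℝ) (hT : 1 ≤ T) : Real.log T ^ 2 ≤ 4 * T := by
  have h0 : 0 ≤ Real.log T := Real.log_nonneg hT
  have h1 : Real.log T ≤ T ^ (1 / 2 : ℝ) / (1 / 2) := Real.log_le_rpow_div (by linarith) (by norm_num)
  have h2 : (T ^ (1 / 2 : ℝ)) ^ 2 = T := by
    rw [← Real.rpow_natCast, ← Real.rpow_mul (by linarith)]; norm_num
  nlinarith [Real.rpow_nonneg (by linarith : (0 : ℝ) ≤ T) (1 / 2 : ℝ)]

/-- **Landau–Gonek, crude form**: for fixed `x > 1`, `‖Σ_{ρ : |Im ρ| ≤ T} m(ρ) x^ρ‖ ≤ C_x · T` for all `T ≥ 2`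
(from the tree's `landau_gonek_formula`). [cite: Gonek1993, Landau's formula] -/
theorem exists_landau_bound {x : ℝ} (hx : 1 < x) :
    ∃ C : ℝ, ∀ T : ℝ, 2 ≤ T →
      ‖∑ ρ ∈ (weilZeroIndex_finite T).toFinset, (riemannZetaZeroOrder ρ : ℂ) * (x : ℂ) ^ ρ‖ ≤ C * T := by
  obtain ⟨C₀, hC₀, hLG⟩ := LandauGonek.landau_gonek_formula
  set Λx : ℝ := if ((⌊x⌋₊ : ℕ) : ℝ) = x then ArithmeticFunction.vonMangoldt ⌊x⌋₊ else 0 with hΛx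
  have hΛx0 : 0 ≤ Λx := by
    rw [hΛx]; split_ifs
    · exact ArithmeticFunction.vonMangoldt_nonneg
    · exact le_rfl
  refine ⟨C₀ * x ^ 2 * ((1 + 1 / Real.log x) ^ 2 * 4 + 1) + Λx / π, fun T hT ↦ ?_⟩
  have h := hLG x hx T hT
  have hT0 : 0 < T := by linarith
  have hmain : ‖(((T / π * Λx : ℝ)) : ℂ)‖ ≤ Λx / π * T := by
    rw [Complex.norm_real, Real.norm_eq_abs, abs_of_nonneg (by positivity)]
    exact le_of_eq (by ring)
  have hmin : min T (x / primePowDist x) ≤ T := min_le_left _ _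
  have hlog : Real.log T ^ 2 ≤ 4 * T := log_sq_le T (by linarith)
  have hsq : 0 ≤ (1 + 1 / Real.log x) ^ 2 := sq_nonneg _
  calc ‖∑ ρ ∈ (weilZeroIndex_finite T).toFinset, (riemannZetaZeroOrder ρ : ℂ) * (x : ℂ) ^ ρ‖
      ≤ ‖∑ ρ ∈ (weilZeroIndex_finite T).toFinset, (riemannZetaZeroOrder ρ : ℂ) * (x : ℂ) ^ ρ +
            (((T / π * Λx : ℝ)) : ℂ)‖ + ‖(((T / π * Λx : ℝ)) : ℂ)‖ := norm_le_add_norm_add _ _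
    _ ≤ C₀ * x ^ 2 * ((1 + 1 / Real.log x) ^ 2 * Real.log T ^ 2 + min T (x / primePowDist x)) + Λx / π * T :=
        add_le_add h hmain
    _ ≤ C₀ * x ^ 2 * ((1 + 1 / Real.log x) ^ 2 * (4 * T) + T) + Λx / π * T := by gcongr
    _ = (C₀ * x ^ 2 * ((1 + 1 / Real.log x) ^ 2 * 4 + 1) + Λx / π) * T := by ring

/-- `e^{(ρ−½) log x} = x^{ρ−½}` for `x > 0`. [folklore] -/
theorem exp_mul_log_eq_cpow {x : ℝ} (hx : 0 < x) (w : ℂ) :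
    Complex.exp (w * (Real.log x : ℂ)) = (x : ℂ) ^ w := by
  rw [Complex.cpow_def_of_ne_zero (Complex.ofReal_ne_zero.2 hx.ne'), ← Complex.ofReal_log hx.le, mul_comm]

/-- The shifted Landau–Gonek bound: for `x > 1`, `‖Σ_{|Im ρ| ≤ T} m(ρ) x^{ρ−½}‖ ≤ C_x T`. [folklore] -/
theorem exists_landau_bound_shift {x : ℝ} (hx : 1 < x) :
    ∃ C : ℝ, ∀ T : ℝ, 2 ≤ T →
      ‖∑ ρ ∈ (weilZeroIndex_finite T).toFinset, (riemannZetaZeroOrder ρ : ℂ) * (x : ℂ) ^ (ρ - 1 / 2)‖ ≤ C * T := by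
  obtain ⟨C, hC⟩ := exists_landau_bound hx
  have hx0 : (x : ℂ) ≠ 0 := Complex.ofReal_ne_zero.2 (by linarith)
  refine ⟨‖(x : ℂ) ^ (-(1 / 2 : ℂ))‖ * C, fun T hT ↦ ?_⟩
  have e : ∑ ρ ∈ (weilZeroIndex_finite T).toFinset, (riemannZetaZeroOrder ρ : ℂ) * (x : ℂ) ^ (ρ - 1 / 2) =
      (x : ℂ) ^ (-(1 / 2 : ℂ)) * ∑ ρ ∈ (weilZeroIndex_finite T).toFinset, (riemannZetaZeroOrder ρ : ℂ) * (x : ℂ) ^ ρ := by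
    rw [Finset.mul_sum]
    refine Finset.sum_congr rfl fun ρ _ ↦ ?_
    rw [sub_eq_add_neg, Complex.cpow_add _ _ hx0]; ring
  rw [e, norm_mul, mul_assoc]
  exact mul_le_mul_of_nonneg_left (hC T hT) (norm_nonneg _)

/-- `weilZeroIndex T` is stable under `ρ ↦ 1 − ρ`. [folklore] -/
theorem one_sub_mem_weilZeroIndex {T : ℝ} {ρ : ℂ} (h : ρ ∈ weilZeroIndex T) : 1 - ρ ∈ weilZeroIndex T := by
  have hnt : ρ ∈ ZetaZeros.riemannZetaNontrivialZeros := by rw [weilZeroIndex_eq_inter] at h; exact h.1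
  obtain ⟨hζ, h0, h1, him, hT⟩ := h
  have hr0 := ZetaZeros.riemannZetaNontrivialZeros.re_pos hnt
  have hr1 := ZetaZeros.riemannZetaNontrivialZeros.re_lt_one hnt
  refine ⟨GeneralizedRH.riemannZeta_one_sub_eq_zero hζ hr0 hr1, ?_, ?_, ?_, ?_⟩
  · simp; linarith
  · simp; linarith
  · simpa using him
  · simpa [abs_neg] using hT

/-- The reflected bound: for `0 < x < 1`, `‖Σ_{|Im ρ| ≤ T} m(ρ) x^{ρ−½}‖ ≤ C_x T` (reindex by `ρ ↦ 1 − ρ`, which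
preserves the index set and the multiplicities and turns `x^{ρ−½}` into `(1/x)^{ρ−½}`). [folklore] -/
theorem exists_landau_bound_shift_lt {x : ℝ} (hx0 : 0 < x) (hx1 : x < 1) :
    ∃ C : ℝ, ∀ T : ℝ, 2 ≤ T →
      ‖∑ ρ ∈ (weilZeroIndex_finite T).toFinset, (riemannZetaZeroOrder ρ : ℂ) * (x : ℂ) ^ (ρ - 1 / 2)‖ ≤ C * T := by
  have hinv : 1 < x⁻¹ := one_lt_inv₀ hx0 |>.2 hx1
  obtain ⟨C, hC⟩ := exists_landau_bound_shift hinv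
  refine ⟨C, fun T hT ↦ ?_⟩
  have e : ∑ ρ ∈ (weilZeroIndex_finite T).toFinset, (riemannZetaZeroOrder ρ : ℂ) * (x : ℂ) ^ (ρ - 1 / 2) =
      ∑ ρ ∈ (weilZeroIndex_finite T).toFinset, (riemannZetaZeroOrder ρ : ℂ) * ((x⁻¹ : ℝ) : ℂ) ^ (ρ - 1 / 2) := by
    -- reindex by the involution `ρ ↦ 1 − ρ`
    refine Finset.sum_nbij' (fun ρ ↦ 1 - ρ) (fun ρ ↦ 1 - ρ) (fun ρ hρ ↦ ?_) (fun ρ hρ ↦ ?_)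
      (fun ρ _ ↦ by ring) (fun ρ _ ↦ by ring) (fun ρ hρ ↦ ?_)
    · rw [Set.Finite.mem_toFinset] at hρ ⊢; exact one_sub_mem_weilZeroIndex hρ
    · rw [Set.Finite.mem_toFinset] at hρ ⊢; exact one_sub_mem_weilZeroIndex hρ
    · rw [Set.Finite.mem_toFinset] at hρ
      have hnt : ρ ∈ ZetaZeros.riemannZetaNontrivialZeros := by
        rw [weilZeroIndex_eq_inter] at hρ; exact hρ.1
      rw [riemannZetaZeroOrder_one_sub_holds (ZetaZeros.riemannZetaNontrivialZeros.re_pos hnt)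
        (ZetaZeros.riemannZetaNontrivialZeros.re_lt_one hnt),
        show (1 : ℂ) - ρ - 1 / 2 = -(ρ - 1 / 2) by ring, Complex.cpow_neg, Complex.ofReal_inv,
        Complex.inv_cpow _ _ (by rw [Complex.arg_ofReal_of_nonneg hx0.le]; exact Real.pi_pos.ne), inv_inv]
  rw [e]
  exact hC T hT

/-! ## The counting side: `Σ_{|Im ρ| ≤ T} m(ρ) ≥ N(T)` and `N(T)/T → ∞` -/

/-- `N(T) ≤ Σ_{ρ ∈ weilZeroIndex T} m(ρ)` (the box `0 < Im ρ ≤ T` is half of the symmetric index set). [folklore] -/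
theorem zetaZeroCount_le_sum (T : ℝ) :
    (zetaZeroCount T : ℝ) ≤ ∑ ρ ∈ (weilZeroIndex_finite T).toFinset, (riemannZetaZeroOrder ρ : ℝ) := by
  classical
  have hA : (zetaZeroBox 0 T).Finite := zetaZeroBox_finite 0 T
  have hsub : hA.toFinset ⊆ (weilZeroIndex_finite T).toFinset := by
    intro ρ hρ
    rw [Set.Finite.mem_toFinset] at hρ ⊢
    rw [weilZeroIndex_eq_union]; exact Or.inl hρ
  have hnn : ∀ ρ ∈ (weilZeroIndex_finite T).toFinset, (0 : ℝ) ≤ riemannZetaZeroOrder ρ := by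
    intro ρ hρ
    rw [Set.Finite.mem_toFinset] at hρ
    exact_mod_cast riemannZetaZeroOrder_nonneg (ne_one_of_riemannZeta_eq_zero hρ.1)
  have hsumA : 0 ≤ ∑ᶠ ρ ∈ zetaZeroBox 0 T, riemannZetaZeroOrder ρ := by
    rw [finsum_mem_eq_finite_toFinset_sum _ hA]
    exact Finset.sum_nonneg fun ρ hρ ↦ by exact_mod_cast hnn ρ (hsub hρ)
  have e : (zetaZeroCount T : ℤ) = ∑ ρ ∈ hA.toFinset, riemannZetaZeroOrder ρ := by
    unfold zetaZeroCount zetaZeroCountRe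
    rw [Int.toNat_of_nonneg hsumA, finsum_mem_eq_finite_toFinset_sum _ hA]
  have e' : (zetaZeroCount T : ℝ) = ∑ ρ ∈ hA.toFinset, (riemannZetaZeroOrder ρ : ℝ) := by
    have := congrArg (fun z : ℤ ↦ (z : ℝ)) e
    push_cast at this
    exact this
  rw [e']
  exact Finset.sum_le_sum_of_subset_of_nonneg hsub fun ρ hρ _ ↦ hnn ρ hρ

/-- The pair sums `Σ_{|Im ρ| ≤ T} m(ρ) e^{(ρ−½)(log x_k − log x_j)}`, `x_i = i+2`, `j ≠ k`, are `O(T)`. [folklore] -/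
theorem exists_pair_bound {n : ℕ} (k j : Fin n) (hjk : j ≠ k) :
    ∃ C : ℝ, ∀ T : ℝ, 2 ≤ T →
      ‖∑ ρ ∈ (weilZeroIndex_finite T).toFinset, (riemannZetaZeroOrder ρ : ℂ) *
        Complex.exp ((ρ - 1 / 2) * ((Real.log ((((k : ℕ) + 2 : ℕ) : ℝ)) - Real.log ((((j : ℕ) + 2 : ℕ) : ℝ)) : ℝ) : ℂ))‖
          ≤ C * T := by
  have hxk : (0 : ℝ) < (((k : ℕ) + 2 : ℕ) : ℝ) := by positivity
  have hxj : (0 : ℝ) < (((j : ℕ) + 2 : ℕ) : ℝ) := by positivity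
  set r : ℝ := (((k : ℕ) + 2 : ℕ) : ℝ) / (((j : ℕ) + 2 : ℕ) : ℝ) with hr
  have hr0 : 0 < r := div_pos hxk hxj
  have hr1 : r ≠ 1 := by
    intro h
    rw [hr, div_eq_one_iff_eq hxj.ne'] at h
    have : (k : ℕ) + 2 = (j : ℕ) + 2 := by exact_mod_cast h
    exact hjk (Fin.ext (by omega)).symm
  have hlog : Real.log ((((k : ℕ) + 2 : ℕ) : ℝ)) - Real.log ((((j : ℕ) + 2 : ℕ) : ℝ)) = Real.log r := by
    rw [hr, Real.log_div hxk.ne' hxj.ne']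
  have key : ∀ T : ℝ, ∑ ρ ∈ (weilZeroIndex_finite T).toFinset, (riemannZetaZeroOrder ρ : ℂ) *
        Complex.exp ((ρ - 1 / 2) * ((Real.log ((((k : ℕ) + 2 : ℕ) : ℝ)) - Real.log ((((j : ℕ) + 2 : ℕ) : ℝ)) : ℝ) : ℂ))
      = ∑ ρ ∈ (weilZeroIndex_finite T).toFinset, (riemannZetaZeroOrder ρ : ℂ) * (r : ℂ) ^ (ρ - 1 / 2) := by
    intro T
    refine Finset.sum_congr rfl fun ρ _ ↦ ?_
    rw [hlog, exp_mul_log_eq_cpow hr0]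
  rcases lt_or_gt_of_ne hr1 with hlt | hgt
  · obtain ⟨C, hC⟩ := exists_landau_bound_shift_lt hr0 hlt
    exact ⟨C, fun T hT ↦ by rw [key]; exact hC T hT⟩
  · obtain ⟨C, hC⟩ := exists_landau_bound_shift hgt
    exact ⟨C, fun T hT ↦ by rw [key]; exact hC T hT⟩

/-- **Step (iv).** If the real combination `R_z(w) = Σ_j z_j (1 − (j+2)^{−w})` vanishes at `w = ρ − ½` for every zero
`ρ` ON the critical line, and only finitely many zeros are off it, then `z = 0`.  Proof: for each `k`, sum
`m(ρ)(k+2)^{ρ−½} R_z(ρ−½)` over `|Im ρ| ≤ T`; the on-line terms vanish and the off-line ones are bounded, while by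
Landau–Gonek every cross term is `O(T)` except the diagonal `j = k`, which is `z_k · Σ_{|Im ρ|≤T} m(ρ) ≥ z_k N(T)`;
since `N(T)/T → ∞`, `z_k = 0`. [folklore; Landau–Gonek + Riemann–von Mangoldt, both tree theorems] -/
theorem eq_zero_of_R_vanish_online (n : ℕ) (z : Fin n → ℝ)
    (hfin : Set.Finite {s : ℂ | riemannZeta s = 0 ∧ 0 < s.re ∧ s.re < 1 ∧ s.re ≠ 1 / 2})
    (hR : ∀ ρ : ℂ, ρ ∈ ZetaZeros.riemannZetaNontrivialZeros → ρ.re = 1 / 2 →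
      ∑ j : Fin n, (z j : ℂ) * (1 - Complex.exp (-((ρ - 1 / 2) * (Real.log (((j : ℕ) + 2 : ℕ) : ℝ) : ℂ)))) = 0) :
    z = 0 := by
  classical
  funext k
  by_contra hk
  -- notation
  set u : Fin n → ℝ := fun j ↦ Real.log (((j : ℕ) + 2 : ℕ) : ℝ) with hu
  set g : ℂ → ℂ := fun ρ ↦ (riemannZetaZeroOrder ρ : ℂ) * (Complex.exp ((ρ - 1 / 2) * (u k : ℂ)) *
      ∑ j : Fin n, (z j : ℂ) * (1 - Complex.exp (-((ρ - 1 / 2) * (u j : ℂ))))) with hg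
  set S : ℝ → ℂ := fun T ↦ ∑ ρ ∈ (weilZeroIndex_finite T).toFinset,
      (riemannZetaZeroOrder ρ : ℂ) * Complex.exp ((ρ - 1 / 2) * (u k : ℂ)) with hS
  set P : Fin n → ℝ → ℂ := fun j T ↦ ∑ ρ ∈ (weilZeroIndex_finite T).toFinset,
      (riemannZetaZeroOrder ρ : ℂ) * Complex.exp ((ρ - 1 / 2) * ((u k - u j : ℝ) : ℂ)) with hP
  set Ntot : ℝ → ℝ := fun T ↦ ∑ ρ ∈ (weilZeroIndex_finite T).toFinset, (riemannZetaZeroOrder ρ : ℝ) with hNtot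
  -- (a) the off-line terms are the only ones: `‖Σ g‖ ≤ K₁`
  have hR' : ∀ ρ : ℂ, ρ ∈ ZetaZeros.riemannZetaNontrivialZeros → ρ.re = 1 / 2 →
      ∑ j : Fin n, (z j : ℂ) * (1 - Complex.exp (-((ρ - 1 / 2) * (u j : ℂ)))) = 0 := fun ρ h1 h2 ↦ hR ρ h1 h2
  set Ofull : Finset ℂ := hfin.toFinset with hOfull
  set K₁ : ℝ := ∑ ρ ∈ Ofull, ‖g ρ‖ with hK₁
  have hga : ∀ T : ℝ, ‖∑ ρ ∈ (weilZeroIndex_finite T).toFinset, g ρ‖ ≤ K₁ := by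
    intro T
    have hzero : ∀ ρ ∈ (weilZeroIndex_finite T).toFinset, g ρ ≠ 0 → ρ ∈ Ofull := by
      intro ρ hρ hgρ
      rw [Set.Finite.mem_toFinset] at hρ
      have hnt : ρ ∈ ZetaZeros.riemannZetaNontrivialZeros := by
        rw [weilZeroIndex_eq_inter] at hρ; exact hρ.1
      rw [hOfull, Set.Finite.mem_toFinset]
      refine ⟨ZetaZeros.riemannZetaNontrivialZeros.zeta_eq_zero hnt, ZetaZeros.riemannZetaNontrivialZeros.re_pos hnt,
        ZetaZeros.riemannZetaNontrivialZeros.re_lt_one hnt, fun hre ↦ hgρ ?_⟩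
      simp only [hg, hR' ρ hnt hre, mul_zero]
    rw [← Finset.sum_filter_of_ne hzero]
    refine (norm_sum_le _ _).trans (Finset.sum_le_sum_of_subset_of_nonneg (fun ρ hρ ↦ (Finset.mem_filter.1 hρ).2)
      fun _ _ _ ↦ norm_nonneg _)
  -- (b) Landau–Gonek constants
  have hxk1 : (1 : ℝ) < (((k : ℕ) + 2 : ℕ) : ℝ) := by exact_mod_cast (show 1 < (k : ℕ) + 2 by omega)
  obtain ⟨CS, hCS⟩ := exists_landau_bound_shift hxk1
  have hSb : ∀ T : ℝ, 2 ≤ T → ‖S T‖ ≤ CS * T := by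
    intro T hT
    have e : S T = ∑ ρ ∈ (weilZeroIndex_finite T).toFinset,
        (riemannZetaZeroOrder ρ : ℂ) * ((((k : ℕ) + 2 : ℕ) : ℝ) : ℂ) ^ (ρ - 1 / 2) := by
      refine Finset.sum_congr rfl fun ρ _ ↦ ?_
      rw [hu]; simp only
      rw [exp_mul_log_eq_cpow (by positivity)]
    rw [e]; exact hCS T hT
  have hPb : ∀ j : Fin n, ∃ C : ℝ, ∀ T : ℝ, 2 ≤ T → j ≠ k → ‖P j T‖ ≤ C * T := by
    intro j
    by_cases hjk : j = k
    · exact ⟨0, fun T _ hne ↦ absurd hjk hne⟩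
    · obtain ⟨C, hC⟩ := exists_pair_bound k j hjk
      exact ⟨C, fun T hT _ ↦ hC T hT⟩
  choose CP hCP using hPb
  -- (c) the identity `z_k · Ntot = (Σ z_j) S − Σ_{j ≠ k} z_j P_j − Σ g`
  have hPk : ∀ T : ℝ, P k T = (Ntot T : ℂ) := by
    intro T
    simp only [hP, hNtot]
    push_cast
    refine Finset.sum_congr rfl fun ρ _ ↦ ?_
    rw [sub_self, mul_zero, Complex.exp_zero, mul_one]
  have hid : ∀ T : ℝ, ∑ ρ ∈ (weilZeroIndex_finite T).toFinset, g ρ =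
      (∑ j : Fin n, (z j : ℂ)) * S T - ∑ j : Fin n, (z j : ℂ) * P j T := by
    intro T
    have e1 : ∀ ρ : ℂ, g ρ = ∑ j : Fin n, (z j : ℂ) * ((riemannZetaZeroOrder ρ : ℂ) *
        Complex.exp ((ρ - 1 / 2) * (u k : ℂ)) - (riemannZetaZeroOrder ρ : ℂ) *
          Complex.exp ((ρ - 1 / 2) * ((u k - u j : ℝ) : ℂ))) := by
      intro ρ
      simp only [hg]
      rw [Finset.mul_sum, Finset.mul_sum]
      refine Finset.sum_congr rfl fun j _ ↦ ?_
      have : Complex.exp ((ρ - 1 / 2) * ((u k - u j : ℝ) : ℂ)) =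
          Complex.exp ((ρ - 1 / 2) * (u k : ℂ)) * Complex.exp (-((ρ - 1 / 2) * (u j : ℂ))) := by
        rw [← Complex.exp_add]; push_cast; ring_nf
      rw [this]; ring
    simp_rw [e1]
    rw [Finset.sum_comm, Finset.sum_mul, ← Finset.sum_sub_distrib]
    refine Finset.sum_congr rfl fun j _ ↦ ?_
    simp only [hS, hP]
    rw [Finset.mul_sum, Finset.mul_sum, ← Finset.sum_sub_distrib]
    exact Finset.sum_congr rfl fun ρ _ ↦ by ring
  have hsplitk : ∀ T : ℝ, ∑ j : Fin n, (z j : ℂ) * P j T =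
      (z k : ℂ) * (Ntot T : ℂ) + ∑ j ∈ Finset.univ.erase k, (z j : ℂ) * P j T := by
    intro T
    rw [← Finset.add_sum_erase _ _ (Finset.mem_univ k), hPk]
  -- (d) norms: `|z_k| Ntot T ≤ K₂ T + K₁` for `T ≥ 2`
  set K₂ : ℝ := (∑ j : Fin n, |z j|) * CS + ∑ j ∈ Finset.univ.erase k, |z j| * CP j with hK₂
  have hNtot0 : ∀ T, 0 ≤ Ntot T := fun T ↦ Finset.sum_nonneg fun ρ hρ ↦ by
    rw [Set.Finite.mem_toFinset] at hρ
    exact_mod_cast riemannZetaZeroOrder_nonneg (ne_one_of_riemannZeta_eq_zero hρ.1)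
  have hbound : ∀ T : ℝ, 2 ≤ T → |z k| * Ntot T ≤ K₂ * T + K₁ := by
    intro T hT
    have e : (z k : ℂ) * (Ntot T : ℂ) = (∑ j : Fin n, (z j : ℂ)) * S T -
        ∑ j ∈ Finset.univ.erase k, (z j : ℂ) * P j T - ∑ ρ ∈ (weilZeroIndex_finite T).toFinset, g ρ := by
      rw [hid T, hsplitk T]; ring
    have hn : |z k| * Ntot T = ‖(z k : ℂ) * (Ntot T : ℂ)‖ := by
      rw [norm_mul, Complex.norm_real, Complex.norm_real, Real.norm_eq_abs, Real.norm_eq_abs,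
        abs_of_nonneg (hNtot0 T)]
    rw [hn, e]
    have h1 : ‖(∑ j : Fin n, (z j : ℂ)) * S T‖ ≤ (∑ j : Fin n, |z j|) * CS * T := by
      rw [norm_mul, mul_assoc]
      refine mul_le_mul ?_ (hSb T hT) (norm_nonneg _) (Finset.sum_nonneg fun _ _ ↦ abs_nonneg _)
      refine (norm_sum_le _ _).trans (le_of_eq (Finset.sum_congr rfl fun j _ ↦ ?_))
      rw [Complex.norm_real, Real.norm_eq_abs]
    have h2 : ‖∑ j ∈ Finset.univ.erase k, (z j : ℂ) * P j T‖ ≤ (∑ j ∈ Finset.univ.erase k, |z j| * CP j) * T := by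
      rw [Finset.sum_mul]
      refine (norm_sum_le _ _).trans (Finset.sum_le_sum fun j hj ↦ ?_)
      rw [norm_mul, Complex.norm_real, Real.norm_eq_abs, mul_assoc]
      exact mul_le_mul_of_nonneg_left (hCP j T hT (Finset.ne_of_mem_erase hj)) (abs_nonneg _)
    have h3 := hga T
    calc ‖(∑ j : Fin n, (z j : ℂ)) * S T - ∑ j ∈ Finset.univ.erase k, (z j : ℂ) * P j T -
          ∑ ρ ∈ (weilZeroIndex_finite T).toFinset, g ρ‖
        ≤ ‖(∑ j : Fin n, (z j : ℂ)) * S T‖ + ‖∑ j ∈ Finset.univ.erase k, (z j : ℂ) * P j T‖ +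
            ‖∑ ρ ∈ (weilZeroIndex_finite T).toFinset, g ρ‖ := by
          have := norm_sub_le ((∑ j : Fin n, (z j : ℂ)) * S T - ∑ j ∈ Finset.univ.erase k, (z j : ℂ) * P j T)
            (∑ ρ ∈ (weilZeroIndex_finite T).toFinset, g ρ)
          have := norm_sub_le ((∑ j : Fin n, (z j : ℂ)) * S T) (∑ j ∈ Finset.univ.erase k, (z j : ℂ) * P j T)
          linarith
      _ ≤ (∑ j : Fin n, |z j|) * CS * T + (∑ j ∈ Finset.univ.erase k, |z j| * CP j) * T + K₁ := by linarith
      _ = K₂ * T + K₁ := by rw [hK₂]; ring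
  -- (e) contradiction with `N(T)/T → ∞`
  have hzk : 0 < |z k| := abs_pos.2 hk
  have hev := LatticeUncertainty.eventually_mul_le_zetaZeroCount ((K₂ + |K₁| + 1) / |z k|)
  obtain ⟨T, hT⟩ := (hev.and (eventually_ge_atTop (2 : ℝ))).exists
  obtain ⟨hNT, hT2⟩ := hT
  have hN' : (zetaZeroCount T : ℝ) ≤ Ntot T := zetaZeroCount_le_sum T
  have h1 : (K₂ + |K₁| + 1) / |z k| * T * |z k| ≤ |z k| * Ntot T := by
    have := mul_le_mul_of_nonneg_right (hNT.trans hN') hzk.le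
    linarith [this]
  have h2 : (K₂ + |K₁| + 1) / |z k| * T * |z k| = (K₂ + |K₁| + 1) * T := by field_simp
  have h3 := hbound T hT2
  have h4 : K₁ ≤ |K₁| := le_abs_self _
  have h5 : |K₁| ≤ |K₁| * T := le_mul_of_one_le_right (abs_nonneg _) (by linarith)
  have h6 : (K₂ + |K₁| + 1) * T ≤ K₂ * T + K₁ := by rw [← h2]; exact h1.trans h3
  nlinarith

end Summit.RiemannHypothesis.RiemannHypothesis.Theorems.Splittings.ScrewNullComb

end
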